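import Literature.NumberTheory.EllipticCurves.LeadingTermBSZNonsplitDensityProofs
import HarnessLib

/-!
# Bhargava–Skinner–Zhang, proof of Lemma 18: the residue densities of `Σ₅^spl` at level `k`
# (`A ≡ 3 (mod 5)`, `ord₅(4A³ + 27B²) = k`, and a condition on `(A, (4A³+27B²)/5^k) mod 25`)

Companion of `LeadingTermBSZNonsplitDensityProofs.lean` (the non-split piece `Σ₅^ns`,
`hasHeightDensity_sigma_ns_five`) for the SPLIT piece of `S₁'(5)`. Source: M. Bhargava, C. Skinner,
W. Zhang, *A majority of elliptic curves over `ℚ` satisfy the Birch and Swinnerton-Dyer conjecture*,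
arXiv:1407.1826v2 (2014), proof of Lemma 18 (p. 9; held text `paper:arxiv-1407.1826` p0008 L104 –
p0009 L21):

> "`Σ₅^spl` is the set of `(A,B)` with `A ≡ 3 (mod 5)` and `B ≡ ±1 (mod 5)` such that
> `5 ∤ ord₅(Δ(A,B))` and `ord₅(𝓛(E_{A,B})) = 1` … Write `q = p^k ω u` with `ω ∈ μ_{p-1}` and
> `u ∈ 1 + pℤ_p`. Then … if `k ≥ 2`, then `u ∈ 1 + p²ℤ_p` if and only if `Δ(A,B)/p^k (mod p²)`
> belongs to `S_k` …; and if `k = 1`, then `u ∈ 1 + p²ℤ_p` if and only if `Δ(A,B)/p (mod p²)`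
> belongs to the set `S₁` … As was explained above, for any `A ≡ 2, 3 (mod 5)`, there are `2(5-1)`
> residue classes modulo `5^{k+2}` (depending on `A` modulo `5^{k+2}`) such that: `ord₅Δ(A,B) = k`
> if and only if `B` belongs to one of these residue classes. … Hence
> `μ₅(Σ₅^spl) = (1-5⁻¹⁰)⁻¹ · Σ_{k=1, 5∤k}^∞ (2p-1)(p-1)/5^{k+3}`" (count corrected to `2(p-1)²` in the
> tree: `bsz_lemma18_card_residues_eq`).

## What this file proves (theorems; ONE elementary definition, no named fact — D-0026)

The class modulo `25` of the unit part `u` of the Tate parameter `q_E = 5^k · u` of `E_{A,B}` is a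
polynomial in `(e, a, δ) = (5^k mod 25, A mod 25, (4A³+27B²)/5^k mod 25)` — `u ≡ J + 744·5^k·J²`
with `J = δ·(6912a³)⁻¹` (the reciprocal `q = 1/j + 744/j² + ⋯` of the `q`-expansion
`1/j = q - 744q² + ⋯` of Silverman, ATAEC, proof of Lemma V.5.1 (p. 405) / Thm V.3.1 (b), read modulo
`5^{k+2}` — the source itself reads `u mod p²` off `Δ(q) = q - 24q² + ⋯` (proof of Lemma 18, p. 9);
proved for the ACTUAL Tate parameter in `TateJSecondOrderProofs.lean`, Part 2, and tied to
the pieces `S₁'`, `T₅`, `SP'` in `BhargavaSkinnerZhang2014/PiecesFiveAdicCriteriaProofs.lean`). Here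
that polynomial is the definition `BSZSigmaSpl.tateUnitResidue e a δ` (inverse modulo `25` written as
the `19`-th power), and the file proves the RESIDUE DENSITIES that the assembly of `μ(Σ₅^spl)`,
`μ(T₅)`, `μ(SP')` needs, in the shape of `BSZSigmaNs.hasHeightDensity_ord_eq`:

* `BSZSigmaSpl.exists_unit_residue_and_iff` — `ord₅ D = k` TOGETHER WITH a condition on
  `D/5^k (mod 25)` as a residue condition modulo `5^{k+2}` (sharpening `BSZSigmaNs.exists_unit_residue_iff`:
  the unit residue `z` is `D/5^k mod 25`);
* `BSZSigmaSpl.card_pairs_of_card_eq` — for any `a ↦ Z a ⊆ ℤ/25` of constant cardinality `n` on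
  `a ≡ 3 (mod 5)`: the pairs `(a, b) mod 5^{k+2}` with `a ≡ 3`, `4a³ + 27b² ≡ 5^k z`, `z ∈ Z(a mod 25)`
  number `5^{k+1}·2n` (`bsz_lemma18_card_residues_eq` class by class);
* `BSZSigmaSpl.card_units_filter_pow_four_ne_one` / `_eq_one` — for `a ≡ 3 (mod 5)` and
  `e ∈ {0, 5}`: exactly `16` (resp. `4`) units `δ (mod 25)` have `tateUnitResidue e a δ ^ 4 ≠ 1`
  (resp. `= 1`) — the source's "`S_k ⊂ ℤ_p^×` of size `p - 1`", by `decide`;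
* `BSZSigmaSpl.hasHeightDensity_ord_eq_of_card_eq` — **density of `{A ≡ 3 (5), ord₅(4A³+27B²) = k,
  P(A mod 25, (4A³+27B²)/5^k mod 25)}` = `5^{k+1}·2n / 5^{2(k+2)} · (1-5⁻¹⁰)⁻¹`** whenever `P(a, ·)`
  cuts `n` unit classes for every `a ≡ 3`; specialised: `hasHeightDensity_ord_eq_pow_four_ne_one`
  (`n = 16`: the level-`k` piece of `Σ₅^spl`, density `32/5^{k+3}·(1-5⁻¹⁰)⁻¹` — the printed summand
  with the corrected count) and `hasHeightDensity_ord_eq_pow_four_eq_one` (`n = 4`: the level-`k`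
  piece of the Tate-fifth-power set when `5 ∣ k`, density `8/5^{k+3}·(1-5⁻¹⁰)⁻¹`);
* `BSZSigmaSpl.hasHeightDensity_ord_ge` — the tail `{A ≡ 3 (5), ord₅ ≥ K+1}` has density
  `2/5^{K+2}·(1-5⁻¹⁰)⁻¹`.

* `hasHeightDensity_sigma_spl_five` — **the sum over `k`: `μ₅(Σ₅^spl) = 8/125·(1 - 4/(5⁵-1))·(1-5⁻¹⁰)⁻¹`**
  (third term of the tree's `bsz_mu_S_one_prime_five`; printed `(99-…)`-value corrected), for the
  residue set `{A ≡ 3, B ≡ ±1 (mod 5), 5 ∤ k := ord₅(4A³+27B²), tateUnitResidue(5^k, A, (4A³+27B²)/5^k)⁴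
  ≢ 1}`, squeezed exactly as `hasHeightDensity_sigma_ns_five`.

* `hasHeightDensity_tateFifthPower_residues_five` — **`Σ_{k ≥ 1, 5 ∣ k}`: the Tate-fifth-power
  residue set** `{A ≡ 3, B ≡ ±1 (mod 5), 5 ∣ k, tateUnitResidue(5^k, A, (4A³+27B²)/5^k)⁴ ≡ 1}` has
  height density `8/125·1/(5⁵-1)·(1-5⁻¹⁰)⁻¹ = 78125/3813476172` (the constant of the binder `hR`;
  `tendsto_partial_sums_mult_five`).

* `hasHeightDensity_sigma_ns_mult_five` (`A ≡ 2, B ≡ ±2 (mod 5), 5 ∣ k`: `8/25·1/(5⁵-1)·(1-5⁻¹⁰)⁻¹`),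
  `hasHeightDensity_split_mult_five_pow_four_ne_one` (`A ≡ 3, B ≡ ±1, 5 ∣ k, tateUnitResidue⁴ ≢ 1`:
  `32/125·1/(5⁵-1)·(1-5⁻¹⁰)⁻¹`), `hasHeightDensity_split_not_mult_five_pow_four_eq_one` (`A ≡ 3,
  B ≡ ±1, 5 ∤ k, tateUnitResidue⁴ ≡ 1`: `8/125·(1/4 - 1/(5⁵-1))·(1-5⁻¹⁰)⁻¹`) and their union
  **`hasHeightDensity_SPprime_residues_five` — the residue set of the slice `P = SP'` has height density
  `20546875/1271158724`** (the constant of the binder `hPd`); `hasHeightDensity_mult_tail_five` /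
  `mult_tail_density_le` — the multiplicative tail `{A ≡ 2, 3 (mod 5), 5^{K+1} ∣ 4A³+27B²}` has height
  density `4/5^{K+2}·(1-5⁻¹⁰)⁻¹ ≤ 10⁻⁶` for `K ≥ 8` (the truncation allowance of `SP'_K`, `T₅Trunc K`).
  Elementary helpers: `tateUnitResidue_def`, `mul_pow_nineteen_eq_one`, `twentyfive_dvd_pow`,
  `hyp_of_castHom_eq_three`, `zmod5_disc_three`.

Not here: the identification of these residue sets with the pieces of
`BhargavaSkinnerZhang2014/Pieces.lean` (`HasHeightDensity Pieces.S₁' μT` / `Pieces.T₅ μR`, binders `hT`,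
`hR`) — cell book `cells/density/C0-SPEC.md`, G10; sibling `BhargavaSkinnerZhang2014/PiecesDensityProofs.lean`.

## References

* M. Bhargava, C. Skinner, W. Zhang, arXiv:1407.1826v2 (2014), proof of Lemma 18 (pp. 8–9: the
  sets `S_k`, "`q = p^k ω u`", "iff `u ∉ 1 + p²ℤ_p`", the count of residue classes modulo `p^{k+2}`),
  Rem. 11 (p. 5: `E[p]` finite at `p` iff `p ∤ ord_p(Δ_p)`), proof of Cor. 26 (p. 12: the set of
  curves in `S₀(5)` "on which the above arguments have not been applied", `S₀(5) ∖ S₁'(5)`).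
  [cite: BhargavaSkinnerZhang2014, Lemma 18 (proof), Rem. 11, Cor. 26 (proof)]
* J. H. Silverman, *Advanced Topics in the Arithmetic of Elliptic Curves*, GTM 151 (1994), Thm. V.3.1
  (b) and proof of Lemma V.5.1 (p. 405) (the `q`-expansion of `1/j` and its reciprocal), Thm. V.5.3
  (Tate's uniformisation: `E(ℚ_p) ≅ ℚ_pˣ/q^ℤ`, whence `E(ℚ₅)[5] ≠ 0 ⟺ q ∈ (ℚ₅ˣ)⁵`).
  [cite: SilvermanATAEC1994, Thm. V.3.1, Lemma V.5.1 (proof), Thm. V.5.3]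
* M. Bhargava, C. Skinner, J. Ramanujan Math. Soc. 29 (2014), proof of Lemma 16 (`E(ℚ_p)[p] = 0` as the
  local input). [cite: BhargavaSkinner2014, proof of Lemma 16]
The split of `S₀(5) ∖ S₁'(5)` by `E(ℚ₅)[5]` into the pieces `R = T₅` and `P = SP'` is the tree's
(`BhargavaSkinnerZhang2014/Pieces.lean`, the bundle `pub-bsdpct`); the source's Cor. 26 treats
`S₀(5) ∖ S₁'(5)` as one set (and `S₁(5) ⊂ S₁'(5)` with `μ(S₁') - μ(S₁) ≤ 10⁻⁵`).
-/

set_option autoImplicit false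

noncomputable section

open Filter Topology

open scoped Classical

namespace Literature.NumberTheory.EllipticCurves

namespace BSZSigmaSpl

open BSZSigmaNs

/-! ### The unit-part polynomial and its residue counts modulo `25` -/

/-- **The unit part of the Tate parameter modulo `25` as a function of residues.** For
`e = 5^k (mod 25)`, `a = A (mod 25)` (a unit) and `δ = (4A³ + 27B²)/5^k (mod 25)`, the class modulo
`25` of `u = q_E/5^k` is `J + 744·e·J²` with `J = δ·(6912a³)⁻¹ = 1/(5^k j(E_{A,B}))` (the reciprocal
`q = 1/j + 744/j² + ⋯` of ATAEC's `1/j = q - 744q² + ⋯` modulo `5^{k+2}` — the source reads `u mod p²`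
off `Δ(q) = q - 24q² + ⋯` instead; the inverse of the unit `6912a³` modulo `25` is its `19`-th power,
`φ(25) = 20`). That this IS the residue of the unit part of the Tate parameter is
`BhargavaSkinnerZhang2014.toZModPow_two_tateUnit_eq` (`TateJSecondOrderProofs.lean`, Part 2).
[cite: BhargavaSkinnerZhang2014, Lemma 18 (proof, p. 9: "q = p^k ω u", "Δ(q) = q - 24q² + ⋯")]
[cite: SilvermanATAEC1994, Thm. V.3.1 (b) and proof of Lemma V.5.1 (p. 405)] -/
def tateUnitResidue (e a δ : ZMod (5 ^ 2)) : ZMod (5 ^ 2) :=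
  δ * (6912 * a ^ 3) ^ 19 + 744 * e * (δ * (6912 * a ^ 3) ^ 19) ^ 2

/-- Unfolding lemma for `tateUnitResidue`. [cite: BhargavaSkinnerZhang2014, Lemma 18 (proof)] -/
theorem tateUnitResidue_def (e a δ : ZMod (5 ^ 2)) :
    tateUnitResidue e a δ = δ * (6912 * a ^ 3) ^ 19 + 744 * e * (δ * (6912 * a ^ 3) ^ 19) ^ 2 := rfl

/-- For a unit `c` modulo `25`, `c¹⁹` is its inverse: `c · c¹⁹ = 1` (`(ℤ/25)ˣ` has order `φ(25) = 20`;
Serre II §3.1). [cite: Serre1973, Ch. II §3.1 (structure of the units modulo p^n)] -/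
theorem mul_pow_nineteen_eq_one :
    ∀ c : ZMod (5 ^ 2), ZMod.castHom five_dvd_twentyfive (ZMod 5) c ≠ 0 → c * c ^ 19 = 1 := by
  decide

/-- `5^k ≡ 0 (mod 25)` for `k ≥ 2`. [folklore] -/
private theorem five_pow_eq_zero_of_two_le {k : ℕ} (hk : 2 ≤ k) : (5 : ZMod (5 ^ 2)) ^ k = 0 := by
  obtain ⟨m, rfl⟩ : ∃ m, k = m + 2 := ⟨k - 2, by omega⟩
  rw [pow_add, show (5 : ZMod (5 ^ 2)) ^ 2 = 0 by decide, mul_zero]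

/-- For `k ≥ 1`, `5^k mod 25 ∈ {0, 5}`. [folklore] -/
private theorem five_pow_eq_zero_or_eq_five {k : ℕ} (hk : 1 ≤ k) :
    (5 : ZMod (5 ^ 2)) ^ k = 0 ∨ (5 : ZMod (5 ^ 2)) ^ k = 5 := by
  rcases Nat.lt_or_ge k 2 with h | h
  · right
    have : k = 1 := by omega
    rw [this, pow_one]
  · exact Or.inl (five_pow_eq_zero_of_two_le h)

set_option maxRecDepth 16000 in
/-- **"a subset `S_k ⊂ ℤ_p^×` of size `p - 1`"** at `p = 5`, complement form: for every
`a ≡ 3 (mod 5)` modulo `25` and `e ∈ {0, 5}`, exactly `16 = 5·4 - 4` units `δ (mod 25)` have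
`tateUnitResidue e a δ ^ 4 ≠ 1` (`δ ↦ δ·(6912a³)⁻¹` permutes the units, `w ↦ w + 744·e·w²` permutes
them when `5 ∣ e`, and `4` units are fourth roots of unity, `bsz_lemma18_mu_four_mod_twentyfive`).
Kernel check by `decide`. [cite: BhargavaSkinnerZhang2014, Lemma 18 (proof: #S_k = p - 1)] -/
theorem card_units_filter_pow_four_ne_one :
    ∀ a : ZMod (5 ^ 2), ZMod.castHom five_dvd_twentyfive (ZMod 5) a = 3 →
      ∀ e : ZMod (5 ^ 2), (e = 0 ∨ e = 5) →
        (((Finset.univ : Finset (ZMod (5 ^ 2))).filter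
            (fun z ↦ ZMod.castHom five_dvd_twentyfive (ZMod 5) z ≠ 0)).filter
          (fun z ↦ tateUnitResidue e a z ^ 4 ≠ 1)).card = 16 := by
  unfold tateUnitResidue
  decide

set_option maxRecDepth 16000 in
/-- The complementary count: exactly `4 = p - 1` units `δ (mod 25)` have `tateUnitResidue e a δ ^ 4 = 1`
(`a ≡ 3 (mod 5)`, `e ∈ {0, 5}`) — the source's `S_k`. Kernel check by `decide`.
[cite: BhargavaSkinnerZhang2014, Lemma 18 (proof: #S_k = p - 1)] -/
theorem card_units_filter_pow_four_eq_one :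
    ∀ a : ZMod (5 ^ 2), ZMod.castHom five_dvd_twentyfive (ZMod 5) a = 3 →
      ∀ e : ZMod (5 ^ 2), (e = 0 ∨ e = 5) →
        (((Finset.univ : Finset (ZMod (5 ^ 2))).filter
            (fun z ↦ ZMod.castHom five_dvd_twentyfive (ZMod 5) z ≠ 0)).filter
          (fun z ↦ tateUnitResidue e a z ^ 4 = 1)).card = 4 := by
  unfold tateUnitResidue
  decide

/-! ### `ord₅ D = k` together with a condition on `D/5^k mod 25`, as a residue condition -/

/-- If `D ≡ 5^k · z (mod 5^{k+2})` for a residue `z (mod 25)`, then `5^k ∣ D` and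
`D/5^k ≡ z (mod 25)`: the unit residue of `BSZSigmaNs.exists_unit_residue_iff` is determined.
[folklore] -/
private theorem dvd_and_intCast_div_eq {k : ℕ} {D : ℤ} {z : ZMod (5 ^ 2)}
    (hD : (D : ZMod (5 ^ (k + 2))) = (5 : ZMod (5 ^ (k + 2))) ^ k * (z.val : ZMod (5 ^ (k + 2)))) :
    (5 : ℤ) ^ k ∣ D ∧ ((D / 5 ^ k : ℤ) : ZMod (5 ^ 2)) = z := by
  have hD' : (D : ZMod (5 ^ (k + 2))) = ((5 ^ k * z.val : ℕ) : ℤ) := by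
    rw [hD]; push_cast; ring
  rw [ZMod.intCast_eq_intCast_iff] at hD'
  have hmod := Int.ModEq.dvd hD'.symm
  push_cast at hmod
  obtain ⟨t, ht⟩ := hmod
  have hDeq : D = 5 ^ k * ((z.val : ℤ) + 25 * t) := by linear_combination ht
  have h5k : (5 : ℤ) ^ k ≠ 0 := pow_ne_zero k (by norm_num)
  refine ⟨⟨(z.val : ℤ) + 25 * t, hDeq⟩, ?_⟩
  rw [hDeq, Int.mul_ediv_cancel_left _ h5k]
  push_cast
  rw [ZMod.natCast_zmod_val, show (25 : ZMod (5 ^ 2)) = 0 by decide, zero_mul, add_zero]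

/-- **`ord₅ D = k ∧ Q(D/5^k mod 25)` as a residue condition modulo `5^{k+2}`**: for any predicate
`Q` on residues modulo `25`, `D ≡ 5^k z (mod 5^{k+2})` for some `z ≢ 0 (mod 5)` with `Q z` iff
`5^k ∣ D`, `5^{k+1} ∤ D` and `Q(D/5^k mod 25)` (the source's "`ord₅Δ(A,B) = k` if and only if `B`
belongs to one of these residue classes" modulo `5^{k+2}`, with the class of `Δ/5^k (mod 25)` kept).
[cite: BhargavaSkinnerZhang2014, Lemma 18 (proof: residue classes modulo p^{k+2})] -/
theorem exists_unit_residue_and_iff {k : ℕ} (D : ℤ) (Q : ZMod (5 ^ 2) → Prop) :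
    (∃ z : ZMod (5 ^ 2), (ZMod.castHom five_dvd_twentyfive (ZMod 5) z ≠ 0 ∧ Q z) ∧
        (D : ZMod (5 ^ (k + 2))) = (5 : ZMod (5 ^ (k + 2))) ^ k * (z.val : ZMod (5 ^ (k + 2)))) ↔
      ((5 : ℤ) ^ k ∣ D ∧ ¬ (5 : ℤ) ^ (k + 1) ∣ D) ∧ Q ((D / 5 ^ k : ℤ) : ZMod (5 ^ 2)) := by
  constructor
  · rintro ⟨z, ⟨hz, hQ⟩, hD⟩
    refine ⟨(exists_unit_residue_iff D).mp ⟨z, hz, hD⟩, ?_⟩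
    rw [(dvd_and_intCast_div_eq hD).2]
    exact hQ
  · rintro ⟨h1, hQ⟩
    obtain ⟨z, hz, hD⟩ := (exists_unit_residue_iff D).mpr h1
    refine ⟨z, ⟨hz, ?_⟩, hD⟩
    rw [← (dvd_and_intCast_div_eq hD).2]
    exact hQ

/-! ### The residue sets modulo `5^{k+2}` with an `A mod 25`-dependent unit condition -/

/-- `25 ∣ 5^{k+2}`: the reduction `ZMod 5^{k+2} → ZMod 25` by which the source reads
"`Δ(A,B)/p^k (mod p²)`" off the class modulo `p^{k+2}`. [cite: BhargavaSkinnerZhang2014, Lemma 18 (proof: Δ(A,B)/p^k (mod p²))] -/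
theorem twentyfive_dvd_pow (k : ℕ) : 5 ^ 2 ∣ 5 ^ (k + 2) := pow_dvd_pow 5 (by omega)

/-- The two reductions of an integer class: modulo `5^{k+2}` then `25` is modulo `25`. [folklore] -/
private theorem castHom_twentyfive_intCast (k : ℕ) (A : ℤ) :
    ZMod.castHom (twentyfive_dvd_pow k) (ZMod (5 ^ 2)) (A : ZMod (5 ^ (k + 2))) = (A : ZMod (5 ^ 2)) :=
  map_intCast _ A

/-- Reducing modulo `25` then modulo `5` is reducing modulo `5`. [folklore] -/
private theorem castHom_five_castHom_twentyfive {k : ℕ} (a : ZMod (5 ^ (k + 2))) :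
    ZMod.castHom five_dvd_twentyfive (ZMod 5) (ZMod.castHom (twentyfive_dvd_pow k) (ZMod (5 ^ 2)) a) =
      ZMod.castHom (five_dvd_pow k) (ZMod 5) a := by
  haveI : NeZero (5 ^ (k + 2)) := ⟨pow_ne_zero _ (by norm_num)⟩
  obtain ⟨A, rfl⟩ := ZMod.intCast_surjective a
  rw [map_intCast, map_intCast, map_intCast]

/-- For `a ≡ 3 (mod 5)`: `a ≢ 0` and `27b² ≡ -4a³` is solvable (`b₀ = 1`: `4·27 + 27 = 135 ≡ 0`) —
the hypotheses of `bsz_lemma18_card_residues_eq`; these are the classes of SPLIT multiplicative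
reduction at `5` (`hasSplitMultiplicativeReductionAtPrime_five_shortWeierstrass_iff`: `A ≡ 3`,
`B ≡ ±1`). [cite: BhargavaSkinnerZhang2014, Lemma 18 (proof: "A ≡ 3 (mod 5) and B ≡ ±1 (mod 5)")] -/
theorem hyp_of_castHom_eq_three {k : ℕ} {a : ZMod (5 ^ (k + 2))}
    (ha : ZMod.castHom (five_dvd_pow k) (ZMod 5) a = 3) :
    ZMod.castHom (five_dvd_pow k) (ZMod 5) a ≠ 0 ∧
      ∃ b₀ : ZMod 5, 4 * (ZMod.castHom (five_dvd_pow k) (ZMod 5) a) ^ 3 + 27 * b₀ ^ 2 = 0 := by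
  rw [ha]
  exact ⟨by decide, ⟨1, by decide⟩⟩

/-- **Cardinality of the residue sets with an `a mod 25`-dependent set of unit residues.** For
`k ≥ 1` and a family `Z : ZMod 25 → Finset (ZMod 25)` with `#Z(a') = n` for every `a' ≡ 3 (mod 5)`,
the pairs `(a, b) (mod 5^{k+2})` with `a ≡ 3 (mod 5)` and `4a³ + 27b² ≡ 5^k z` for some
`z ∈ Z(a mod 25)` number `5^{k+1}·2n` (`bsz_lemma18_card_residues_eq` on each of the `5^{k+1}` classes
`a`; companion of `BSZSigmaNs.card_pairs`). [cite: BhargavaSkinnerZhang2014, Lemma 18 (proof: the residue count, corrected)] -/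
theorem card_pairs_of_card_eq (k : ℕ) (hk : 1 ≤ k) (Z : ZMod (5 ^ 2) → Finset (ZMod (5 ^ 2)))
    (n : ℕ) (hZ : ∀ a' : ZMod (5 ^ 2), ZMod.castHom five_dvd_twentyfive (ZMod 5) a' = 3 →
      (Z a').card = n) :
    ((Finset.univ : Finset (ZMod (5 ^ (k + 2)) × ZMod (5 ^ (k + 2)))).filter
      (fun r ↦ ZMod.castHom (five_dvd_pow k) (ZMod 5) r.1 = 3 ∧
        ∃ z ∈ Z (ZMod.castHom (twentyfive_dvd_pow k) (ZMod (5 ^ 2)) r.1),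
          4 * r.1 ^ 3 + 27 * r.2 ^ 2 =
            (5 : ZMod (5 ^ (k + 2))) ^ k * (z.val : ZMod (5 ^ (k + 2))))).card =
      5 ^ (k + 1) * (2 * n) := by
  haveI : Fact (Nat.Prime 5) := ⟨Nat.prime_five⟩
  haveI : NeZero (5 ^ (k + 2)) := ⟨pow_ne_zero _ (by norm_num)⟩
  set red := ZMod.castHom (five_dvd_pow k) (ZMod 5) with hred
  set red₂ := ZMod.castHom (twentyfive_dvd_pow k) (ZMod (5 ^ 2)) with hred₂
  have hcount : ∀ a : ZMod (5 ^ (k + 2)), red a = 3 →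
      ((Finset.univ : Finset (ZMod (5 ^ (k + 2)))).filter (fun b ↦ ∃ z ∈ Z (red₂ a),
        4 * a ^ 3 + 27 * b ^ 2 =
          (5 : ZMod (5 ^ (k + 2))) ^ k * (z.val : ZMod (5 ^ (k + 2))))).card = 2 * n := by
    intro a ha
    obtain ⟨hA, hsol⟩ := hyp_of_castHom_eq_three ha
    have ha' : ZMod.castHom five_dvd_twentyfive (ZMod 5) (red₂ a) = 3 := by
      rw [hred₂, castHom_five_castHom_twentyfive]; exact ha
    have h := bsz_lemma18_card_residues_eq (p := 5) le_rfl hk a hA hsol (Z (red₂ a))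
    rw [hZ _ ha'] at h
    simpa using h
  rw [Finset.card_filter, ← Finset.univ_product_univ, Finset.sum_product]
  have hinner : ∀ a : ZMod (5 ^ (k + 2)),
      (∑ b : ZMod (5 ^ (k + 2)), if red (a, b).1 = 3 ∧ ∃ z ∈ Z (red₂ (a, b).1),
          4 * (a, b).1 ^ 3 + 27 * (a, b).2 ^ 2 =
            (5 : ZMod (5 ^ (k + 2))) ^ k * (z.val : ZMod (5 ^ (k + 2))) then 1 else 0) =
        if red a = 3 then 2 * n else 0 := by
    intro a
    by_cases ha : red a = 3
    · rw [if_pos ha, ← hcount a ha, Finset.card_filter]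
      exact Finset.sum_congr rfl fun b _ ↦ by simp [ha]
    · rw [if_neg ha]
      exact Finset.sum_eq_zero fun b _ ↦ by simp [ha]
  rw [Finset.sum_congr rfl fun a _ ↦ hinner a, Finset.sum_ite, Finset.sum_const_zero, add_zero,
    Finset.sum_const, smul_eq_mul, card_fibre k 3]

/-! ### The residue densities -/

/-- **Density of `{A ≡ 3 (mod 5), ord₅(4A³ + 27B²) = k, P(A, (4A³+27B²)/5^k) (mod 25)}`** (`k ≥ 1`):
if for every `a ≡ 3 (mod 5)` the predicate `P a` cuts out `n` of the `20` unit classes modulo `25`,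
the density is `5^{k+1}·2n/5^{2(k+2)}·(1-5⁻¹⁰)⁻¹ = 2n/5^{k+3}·(1-5⁻¹⁰)⁻¹` (a residue condition
modulo `5^{k+2}`, `exists_unit_residue_and_iff`, counted by `card_pairs_of_card_eq`,
`hasHeightDensity_residues`). With `n = 20` (no condition) this is the printed "`2(5-1)/5^{k+2}`".
[cite: BhargavaSkinnerZhang2014, Lemma 18 (proof)] -/
theorem hasHeightDensity_ord_eq_of_card_eq {k : ℕ} (hk : 1 ≤ k)
    (P : ZMod (5 ^ 2) → ZMod (5 ^ 2) → Prop) [∀ a, DecidablePred (P a)] (n : ℕ)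
    (hP : ∀ a : ZMod (5 ^ 2), ZMod.castHom five_dvd_twentyfive (ZMod 5) a = 3 →
      (((Finset.univ : Finset (ZMod (5 ^ 2))).filter
          (fun z ↦ ZMod.castHom five_dvd_twentyfive (ZMod 5) z ≠ 0)).filter (P a)).card = n) :
    HasHeightDensity (fun AB : ℤ × ℤ ↦ (AB.1 : ZMod 5) = 3 ∧
        ((5 : ℤ) ^ k ∣ 4 * AB.1 ^ 3 + 27 * AB.2 ^ 2 ∧ ¬ (5 : ℤ) ^ (k + 1) ∣ 4 * AB.1 ^ 3 + 27 * AB.2 ^ 2) ∧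
        P (AB.1 : ZMod (5 ^ 2)) (((4 * AB.1 ^ 3 + 27 * AB.2 ^ 2) / 5 ^ k : ℤ) : ZMod (5 ^ 2)))
      (((5 ^ (k + 1) * (2 * n) : ℕ) : ℝ) / ((5 : ℝ) ^ (k + 2)) ^ 2 / (1 - 1 / (5 : ℝ) ^ 10)) := by
  set Zu : Finset (ZMod (5 ^ 2)) := (Finset.univ : Finset (ZMod (5 ^ 2))).filter
      (fun z ↦ ZMod.castHom five_dvd_twentyfive (ZMod 5) z ≠ 0) with hZu
  set Z : ZMod (5 ^ 2) → Finset (ZMod (5 ^ 2)) := fun a ↦ Zu.filter (P a) with hZdef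
  set R : Finset (ZMod (5 ^ (k + 2)) × ZMod (5 ^ (k + 2))) :=
    (Finset.univ : Finset (ZMod (5 ^ (k + 2)) × ZMod (5 ^ (k + 2)))).filter
      (fun r ↦ ZMod.castHom (five_dvd_pow k) (ZMod 5) r.1 = 3 ∧
        ∃ z ∈ Z (ZMod.castHom (twentyfive_dvd_pow k) (ZMod (5 ^ 2)) r.1),
          4 * r.1 ^ 3 + 27 * r.2 ^ 2 =
            (5 : ZMod (5 ^ (k + 2))) ^ k * (z.val : ZMod (5 ^ (k + 2)))) with hRdef
  have hmem : ∀ AB : ℤ × ℤ,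
      (((AB.1 : ZMod (5 ^ (k + 2))), (AB.2 : ZMod (5 ^ (k + 2)))) ∈ R) ↔
        ((AB.1 : ZMod 5) = 3 ∧
          ((5 : ℤ) ^ k ∣ 4 * AB.1 ^ 3 + 27 * AB.2 ^ 2 ∧
            ¬ (5 : ℤ) ^ (k + 1) ∣ 4 * AB.1 ^ 3 + 27 * AB.2 ^ 2) ∧
          P (AB.1 : ZMod (5 ^ 2)) (((4 * AB.1 ^ 3 + 27 * AB.2 ^ 2) / 5 ^ k : ℤ) : ZMod (5 ^ 2))) := by
    intro AB
    rw [hRdef, Finset.mem_filter, castHom_intCast, castHom_twentyfive_intCast]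
    simp only [Finset.mem_univ, true_and, hZdef, hZu, Finset.mem_filter]
    rw [show (4 * (AB.1 : ZMod (5 ^ (k + 2))) ^ 3 + 27 * (AB.2 : ZMod (5 ^ (k + 2))) ^ 2) =
        ((4 * AB.1 ^ 3 + 27 * AB.2 ^ 2 : ℤ) : ZMod (5 ^ (k + 2))) by push_cast; ring]
    rw [show (∃ z, ((ZMod.castHom five_dvd_twentyfive (ZMod 5)) z ≠ 0 ∧ P (AB.1 : ZMod (5 ^ 2)) z) ∧
        ((4 * AB.1 ^ 3 + 27 * AB.2 ^ 2 : ℤ) : ZMod (5 ^ (k + 2))) =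
          (5 : ZMod (5 ^ (k + 2))) ^ k * (z.val : ZMod (5 ^ (k + 2)))) ↔ _ from
      exists_unit_residue_and_iff (4 * AB.1 ^ 3 + 27 * AB.2 ^ 2) (P (AB.1 : ZMod (5 ^ 2)))]
  have hR : ∀ AB : ℤ × ℤ, ((AB.1 : ZMod (5 ^ (k + 2))), (AB.2 : ZMod (5 ^ (k + 2)))) ∈ R →
      ¬ ((5 : ℕ) : ℤ) ∣ AB.1 := by
    intro AB h h5
    have h2 := ((hmem AB).mp h).1
    have h0 := (ZMod.intCast_zmod_eq_zero_iff_dvd AB.1 5).mpr h5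
    rw [h0] at h2
    exact absurd h2 (by decide)
  have hcard : R.card = 5 ^ (k + 1) * (2 * n) := by
    rw [hRdef, card_pairs_of_card_eq k hk Z n (fun a' ha' ↦ by rw [hZdef]; exact hP a' ha')]
  have h := hasHeightDensity_residues (by norm_num : (5 : ℕ).Prime) (k + 2) R hR
  have hfun : (fun AB : ℤ × ℤ ↦ ((AB.1 : ZMod (5 ^ (k + 2))), (AB.2 : ZMod (5 ^ (k + 2)))) ∈ R) =
      (fun AB : ℤ × ℤ ↦ (AB.1 : ZMod 5) = 3 ∧
        ((5 : ℤ) ^ k ∣ 4 * AB.1 ^ 3 + 27 * AB.2 ^ 2 ∧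
          ¬ (5 : ℤ) ^ (k + 1) ∣ 4 * AB.1 ^ 3 + 27 * AB.2 ^ 2) ∧
        P (AB.1 : ZMod (5 ^ 2)) (((4 * AB.1 ^ 3 + 27 * AB.2 ^ 2) / 5 ^ k : ℤ) : ZMod (5 ^ 2))) :=
    funext fun AB ↦ propext (hmem AB)
  rw [hfun, hcard] at h
  push_cast at h ⊢
  exact h

/-- **The level-`k` piece of `Σ₅^spl` has density `32/5^{k+3}·(1-5⁻¹⁰)⁻¹`** (`k ≥ 1`): the pairs
with `A ≡ 3 (mod 5)`, `ord₅(4A³+27B²) = k` and `tateUnitResidue (5^k) A ((4A³+27B²)/5^k) ^ 4 ≢ 1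
(mod 25)` — i.e., once read on the Tate parameter (`TateJSecondOrderProofs` Part 2,
`PiecesFiveAdicCriteriaProofs`), the split curves of level `k` with `ord₅ 𝓛(E_{A,B}) = 1` when
`5 ∤ k`. The printed summand, with the count corrected to `2(p-1)² = 32`.
[cite: BhargavaSkinnerZhang2014, Lemma 18 (proof: μ₅(Σ₅^spl), summand corrected)] -/
theorem hasHeightDensity_ord_eq_pow_four_ne_one {k : ℕ} (hk : 1 ≤ k) :
    HasHeightDensity (fun AB : ℤ × ℤ ↦ (AB.1 : ZMod 5) = 3 ∧
        ((5 : ℤ) ^ k ∣ 4 * AB.1 ^ 3 + 27 * AB.2 ^ 2 ∧ ¬ (5 : ℤ) ^ (k + 1) ∣ 4 * AB.1 ^ 3 + 27 * AB.2 ^ 2) ∧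
        tateUnitResidue ((5 : ZMod (5 ^ 2)) ^ k) (AB.1 : ZMod (5 ^ 2))
            (((4 * AB.1 ^ 3 + 27 * AB.2 ^ 2) / 5 ^ k : ℤ) : ZMod (5 ^ 2)) ^ 4 ≠ 1)
      (((5 ^ (k + 1) * (2 * 16) : ℕ) : ℝ) / ((5 : ℝ) ^ (k + 2)) ^ 2 / (1 - 1 / (5 : ℝ) ^ 10)) := by
  refine hasHeightDensity_ord_eq_of_card_eq hk
    (fun a δ ↦ tateUnitResidue ((5 : ZMod (5 ^ 2)) ^ k) a δ ^ 4 ≠ 1) 16 ?_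
  intro a ha
  convert card_units_filter_pow_four_ne_one a ha _ (five_pow_eq_zero_or_eq_five hk) using 3

/-- **The level-`k` piece of the Tate-fifth-power residue set has density `8/5^{k+3}·(1-5⁻¹⁰)⁻¹`**
(`k ≥ 1`): `A ≡ 3 (mod 5)`, `ord₅(4A³+27B²) = k` and `tateUnitResidue (5^k) A ((4A³+27B²)/5^k) ^ 4
≡ 1 (mod 25)` (for `5 ∣ k` these are the split curves with `q_E ∈ (ℚ₅ˣ)⁵`, `PiecesFiveAdicCriteriaProofs`,
`T₅_iff`); the count is the source's (Lemma 18, proof: the classes modulo `p^{k+2}`), the condition the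
tree's piece `T₅`. [cite: BhargavaSkinnerZhang2014, Lemma 18 (proof, pp. 8–9: S_k, "iff u ∉ 1 + p²ℤ_p", residue classes modulo p^{k+2})]
[cite: SilvermanATAEC1994, Thm. V.5.3] -/
theorem hasHeightDensity_ord_eq_pow_four_eq_one {k : ℕ} (hk : 1 ≤ k) :
    HasHeightDensity (fun AB : ℤ × ℤ ↦ (AB.1 : ZMod 5) = 3 ∧
        ((5 : ℤ) ^ k ∣ 4 * AB.1 ^ 3 + 27 * AB.2 ^ 2 ∧ ¬ (5 : ℤ) ^ (k + 1) ∣ 4 * AB.1 ^ 3 + 27 * AB.2 ^ 2) ∧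
        tateUnitResidue ((5 : ZMod (5 ^ 2)) ^ k) (AB.1 : ZMod (5 ^ 2))
            (((4 * AB.1 ^ 3 + 27 * AB.2 ^ 2) / 5 ^ k : ℤ) : ZMod (5 ^ 2)) ^ 4 = 1)
      (((5 ^ (k + 1) * (2 * 4) : ℕ) : ℝ) / ((5 : ℝ) ^ (k + 2)) ^ 2 / (1 - 1 / (5 : ℝ) ^ 10)) := by
  refine hasHeightDensity_ord_eq_of_card_eq hk
    (fun a δ ↦ tateUnitResidue ((5 : ZMod (5 ^ 2)) ^ k) a δ ^ 4 = 1) 4 ?_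
  intro a ha
  convert card_units_filter_pow_four_eq_one a ha _ (five_pow_eq_zero_or_eq_five hk) using 3

/-- **Density of `{A ≡ 3 (mod 5), ord₅(4A³ + 27B²) ≥ K + 1}`** (`K ≥ 1`):
`10·5^{K+1}/5^{2(K+2)}·(1-5⁻¹⁰)⁻¹ = 2/5^{K+2}·(1-5⁻¹⁰)⁻¹ → 0` — the tail discarded by the printed
sum over `k` (companion of `BSZSigmaNs.hasHeightDensity_ord_ge`).
[cite: BhargavaSkinnerZhang2014, Lemma 18 (proof: the sum over k ≥ 1, tail)] -/
theorem hasHeightDensity_ord_ge {K : ℕ} (hK : 1 ≤ K) :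
    HasHeightDensity (fun AB : ℤ × ℤ ↦ (AB.1 : ZMod 5) = 3 ∧
        (5 : ℤ) ^ (K + 1) ∣ 4 * AB.1 ^ 3 + 27 * AB.2 ^ 2)
      (((5 ^ (K + 1) * (2 * 5) : ℕ) : ℝ) / ((5 : ℝ) ^ (K + 2)) ^ 2 / (1 - 1 / (5 : ℝ) ^ 10)) := by
  set Z0 : Finset (ZMod (5 ^ 2)) := (Finset.univ : Finset (ZMod (5 ^ 2))).filter
      (fun z ↦ ZMod.castHom five_dvd_twentyfive (ZMod 5) z = 0) with hZ0
  set R : Finset (ZMod (5 ^ (K + 2)) × ZMod (5 ^ (K + 2))) :=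
    (Finset.univ : Finset (ZMod (5 ^ (K + 2)) × ZMod (5 ^ (K + 2)))).filter
      (fun r ↦ ZMod.castHom (five_dvd_pow K) (ZMod 5) r.1 = 3 ∧
        ∃ z ∈ (fun _ : ZMod (5 ^ 2) ↦ Z0) (ZMod.castHom (twentyfive_dvd_pow K) (ZMod (5 ^ 2)) r.1),
          4 * r.1 ^ 3 + 27 * r.2 ^ 2 =
            (5 : ZMod (5 ^ (K + 2))) ^ K * (z.val : ZMod (5 ^ (K + 2)))) with hRdef
  have hmem : ∀ AB : ℤ × ℤ,
      (((AB.1 : ZMod (5 ^ (K + 2))), (AB.2 : ZMod (5 ^ (K + 2)))) ∈ R) ↔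
        ((AB.1 : ZMod 5) = 3 ∧ (5 : ℤ) ^ (K + 1) ∣ 4 * AB.1 ^ 3 + 27 * AB.2 ^ 2) := by
    intro AB
    rw [hRdef, Finset.mem_filter, castHom_intCast]
    simp only [Finset.mem_univ, true_and, hZ0, Finset.mem_filter]
    rw [show (4 * (AB.1 : ZMod (5 ^ (K + 2))) ^ 3 + 27 * (AB.2 : ZMod (5 ^ (K + 2))) ^ 2) =
        ((4 * AB.1 ^ 3 + 27 * AB.2 ^ 2 : ℤ) : ZMod (5 ^ (K + 2))) by push_cast; ring]
    rw [show (∃ z, (ZMod.castHom five_dvd_twentyfive (ZMod 5)) z = 0 ∧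
        ((4 * AB.1 ^ 3 + 27 * AB.2 ^ 2 : ℤ) : ZMod (5 ^ (K + 2))) =
          (5 : ZMod (5 ^ (K + 2))) ^ K * (z.val : ZMod (5 ^ (K + 2)))) ↔ _ from
      exists_zero_residue_iff (4 * AB.1 ^ 3 + 27 * AB.2 ^ 2)]
  have hR : ∀ AB : ℤ × ℤ, ((AB.1 : ZMod (5 ^ (K + 2))), (AB.2 : ZMod (5 ^ (K + 2)))) ∈ R →
      ¬ ((5 : ℕ) : ℤ) ∣ AB.1 := by
    intro AB h h5
    have h2 := ((hmem AB).mp h).1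
    have h0 := (ZMod.intCast_zmod_eq_zero_iff_dvd AB.1 5).mpr h5
    rw [h0] at h2
    exact absurd h2 (by decide)
  have hcard : R.card = 5 ^ (K + 1) * (2 * 5) := by
    rw [hRdef, card_pairs_of_card_eq K hK (fun _ ↦ Z0) 5
      (fun _ _ ↦ by rw [hZ0]; exact card_nonunits_mod_twentyfive)]
  have h := hasHeightDensity_residues (by norm_num : (5 : ℕ).Prime) (K + 2) R hR
  have hfun : (fun AB : ℤ × ℤ ↦ ((AB.1 : ZMod (5 ^ (K + 2))), (AB.2 : ZMod (5 ^ (K + 2)))) ∈ R) =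
      (fun AB : ℤ × ℤ ↦ (AB.1 : ZMod 5) = 3 ∧ (5 : ℤ) ^ (K + 1) ∣ 4 * AB.1 ^ 3 + 27 * AB.2 ^ 2) :=
    funext fun AB ↦ propext (hmem AB)
  rw [hfun, hcard] at h
  push_cast at h ⊢
  exact h

end BSZSigmaSpl

/-! ### `μ₅(Σ₅^spl) = 8/125 · (1 - 4/(5⁵ - 1)) · (1 - 5⁻¹⁰)⁻¹` (summand count corrected) -/

open BSZSigmaNs BSZSigmaSpl in
/-- For `A ≡ 3 (mod 5)`: `5 ∣ 4A³ + 27B² ↔ B ≡ ±1 (mod 5)` (`4·27 + 27B² ≡ 2(B² - 1)`).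
[cite: BhargavaSkinnerZhang2014, Lemma 18 (proof: "A ≡ 3 (mod 5) and B ≡ ±1 (mod 5) (so 5 ∣ Δ(A,B))")] -/
theorem zmod5_disc_three : ∀ b : ZMod 5, 4 * (3 : ZMod 5) ^ 3 + 27 * b ^ 2 = 0 ↔ (b = 1 ∨ b = 4) := by
  decide

open BSZSigmaNs BSZSigmaSpl in
/-- **Bhargava–Skinner–Zhang, proof of Lemma 18: `μ₅(Σ₅^spl) = 8/125 · (1 - 4/(5⁵-1)) · (1-5⁻¹⁰)⁻¹`**
— the `5`-adic density of the residue set `Σ₅^spl = {A ≡ 3, B ≡ ±1 (mod 5), 5 ∤ k := ord₅(4A³+27B²),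
tateUnitResidue(5^k, A, (4A³+27B²)/5^k)⁴ ≢ 1 (mod 25)}` (the split multiplicative curves of `S₁'(5)`
once read on the Tate parameter: `PiecesFiveAdicCriteriaProofs`, `TateJSecondOrderProofs` Part 2), as a
height density over the family: the printed `Σ_{k ≥ 1, 5 ∤ k}` of the level-`k` densities
(`BSZSigmaSpl.hasHeightDensity_ord_eq_pow_four_ne_one`, summand `32/5^{k+3}` with the corrected
count `2(p-1)² = 32` for the printed `(2p-1)(p-1) = 36`), squeezed against the tail
(`BSZSigmaSpl.hasHeightDensity_ord_ge`) exactly as for `Σ₅^ns` (`hasHeightDensity_sigma_ns_five`).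
The value is the third term of the tree's `bsz_mu_S_one_prime_five`.
[cite: BhargavaSkinnerZhang2014, Lemma 18 (proof: μ₅(Σ₅^spl), value corrected)] -/
theorem hasHeightDensity_sigma_spl_five :
    HasHeightDensity (fun AB : ℤ × ℤ ↦ (AB.1 : ZMod 5) = 3 ∧ ((AB.2 : ZMod 5) = 1 ∨ (AB.2 : ZMod 5) = 4) ∧
        ¬ 5 ∣ padicValInt 5 (4 * AB.1 ^ 3 + 27 * AB.2 ^ 2) ∧
        tateUnitResidue ((5 : ZMod (5 ^ 2)) ^ padicValInt 5 (4 * AB.1 ^ 3 + 27 * AB.2 ^ 2))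
            (AB.1 : ZMod (5 ^ 2))
            (((4 * AB.1 ^ 3 + 27 * AB.2 ^ 2) / 5 ^ padicValInt 5 (4 * AB.1 ^ 3 + 27 * AB.2 ^ 2) : ℤ) :
              ZMod (5 ^ 2)) ^ 4 ≠ 1)
      (8 / 125 * (1 - 4 / (5 ^ 5 - 1)) / (1 - 1 / (5 : ℝ) ^ 10)) := by
  -- the pieces
  set D : ℤ × ℤ → ℤ := fun AB ↦ 4 * AB.1 ^ 3 + 27 * AB.2 ^ 2 with hD
  set C : ℕ → ℤ × ℤ → Prop := fun k AB ↦
    tateUnitResidue ((5 : ZMod (5 ^ 2)) ^ k) (AB.1 : ZMod (5 ^ 2)) ((D AB / 5 ^ k : ℤ) : ZMod (5 ^ 2))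
      ^ 4 ≠ 1 with hC
  set E : ℕ → ℤ × ℤ → Prop := fun k AB ↦ (AB.1 : ZMod 5) = 3 ∧ ((5 : ℤ) ^ k ∣ D AB ∧
      ¬ (5 : ℤ) ^ (k + 1) ∣ D AB) ∧ C k AB with hE
  set S : ℕ → Finset ℕ := fun K ↦ (Finset.range (K + 1 + 1)).filter (fun k ↦ 1 ≤ k ∧ ¬ 5 ∣ k)
    with hS
  set L : ℕ → ℤ × ℤ → Prop := fun K AB ↦ ∃ k ∈ S K, E k AB with hL
  set F : ℕ → ℤ × ℤ → Prop := fun K AB ↦ (AB.1 : ZMod 5) = 3 ∧ (5 : ℤ) ^ (K + 1 + 1) ∣ D AB with hF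
  set U : ℕ → ℤ × ℤ → Prop := fun K AB ↦ L K AB ∨ F K AB with hU
  set c : ℝ := 1 - 1 / (5 : ℝ) ^ 10 with hc
  set e : ℕ → ℝ := fun k ↦ ((5 ^ (k + 1) * (2 * 16) : ℕ) : ℝ) / ((5 : ℝ) ^ (k + 2)) ^ 2 / c with he
  set f : ℕ → ℝ := fun K ↦ ((5 ^ (K + 1 + 1) * (2 * 5) : ℕ) : ℝ) / ((5 : ℝ) ^ (K + 1 + 2)) ^ 2 / c
    with hf
  set ℓ : ℕ → ℝ := fun K ↦ ∑ k ∈ S K, e k with hℓ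
  have hc0 : c ≠ 0 := by rw [hc]; norm_num
  -- disjointness of the `E k`
  have hEdisj : ∀ i j : ℕ, i ≠ j → ∀ AB : ℤ × ℤ, E i AB → ¬ E j AB := by
    intro i j hij AB ⟨_, ⟨hi1, hi2⟩, _⟩ ⟨_, ⟨hj1, hj2⟩, _⟩
    rcases Nat.lt_or_gt_of_ne hij with h | h
    · exact hi2 ((pow_dvd_pow (5 : ℤ) (Nat.succ_le_of_lt h)).trans hj1)
    · exact hj2 ((pow_dvd_pow (5 : ℤ) (Nat.succ_le_of_lt h)).trans hi1)
  -- densities of `L K` and `U K`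
  have hLd : ∀ K, HasHeightDensity (L K) (ℓ K) := fun K ↦
    HasHeightDensity.finset_biSup (S K) E e
      (fun k hk ↦ by
        have hk1 : 1 ≤ k := ((Finset.mem_filter.mp hk).2).1
        exact hasHeightDensity_ord_eq_pow_four_ne_one hk1)
      (fun i _ j _ hij AB _ ↦ hEdisj i j hij AB)
  have hUd : ∀ K, HasHeightDensity (U K) (ℓ K + f K) := fun K ↦
    (hLd K).or_of_disjoint (BSZSigmaSpl.hasHeightDensity_ord_ge (K := K + 1) (by omega)) (by
      rintro AB - ⟨k, hk, -, ⟨-, hk2⟩, -⟩ ⟨-, hF2⟩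
      have hkK : k + 1 ≤ K + 1 + 1 := by
        have := Finset.mem_range.mp (Finset.mem_filter.mp hk).1
        omega
      exact hk2 ((pow_dvd_pow (5 : ℤ) hkK).trans hF2))
  -- residues: `A ≡ 3`, then `5 ∣ D ↔ B ≡ ±1`
  have hres : ∀ AB : ℤ × ℤ, (AB.1 : ZMod 5) = 3 →
      ((5 : ℤ) ∣ D AB ↔ ((AB.2 : ZMod 5) = 1 ∨ (AB.2 : ZMod 5) = 4)) := by
    intro AB hA
    rw [← zmod5_disc_three, ← hA]
    have : (4 * (AB.1 : ZMod 5) ^ 3 + 27 * (AB.2 : ZMod 5) ^ 2) = ((D AB : ℤ) : ZMod 5) := by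
      rw [hD]; push_cast; ring
    rw [this, ZMod.intCast_zmod_eq_zero_iff_dvd]
    push_cast
    rfl
  refine hasHeightDensity_of_squeeze L U ℓ (fun K ↦ ℓ K + f K) hLd hUd ?_ ?_ ?_ ?_
  · -- `L K ⊆ Σ₅^spl`
    rintro K AB - ⟨k, hk, hA, ⟨hk1, hk2⟩, hCk⟩
    have hk' := (Finset.mem_filter.mp hk).2
    refine ⟨hA, (hres AB hA).mp ((dvd_pow_self (5 : ℤ) (by omega)).trans hk1), ?_, ?_⟩
    · rw [show (4 * AB.1 ^ 3 + 27 * AB.2 ^ 2 : ℤ) = D AB from rfl,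
        padicValInt_eq_of_dvd_of_not_dvd hk1 hk2]
      exact hk'.2
    · rw [show (4 * AB.1 ^ 3 + 27 * AB.2 ^ 2 : ℤ) = D AB from rfl,
        padicValInt_eq_of_dvd_of_not_dvd hk1 hk2]
      exact hCk
  · -- `Σ₅^spl ⊆ U K`
    rintro K AB hfam ⟨hA, hB, hv, hCv⟩
    have hD0 : D AB ≠ 0 := hfam.1
    rw [show (4 * AB.1 ^ 3 + 27 * AB.2 ^ 2 : ℤ) = D AB from rfl] at hv hCv
    have h5D : (5 : ℤ) ∣ D AB := (hres AB hA).mpr hB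
    obtain ⟨hv1, hv2⟩ := dvd_and_not_dvd_padicValInt hD0
    have hv0 : 1 ≤ padicValInt 5 (D AB) := by
      by_contra h
      have h0 : padicValInt 5 (D AB) = 0 := by omega
      rw [h0, zero_add, pow_one] at hv2
      exact hv2 h5D
    by_cases hvK : padicValInt 5 (D AB) ≤ K + 1
    · left
      exact ⟨padicValInt 5 (D AB),
        Finset.mem_filter.mpr ⟨Finset.mem_range.mpr (by omega), hv0, hv⟩, hA, ⟨hv1, hv2⟩, hCv⟩
    · right
      exact ⟨hA, (pow_dvd_pow (5 : ℤ) (by omega)).trans hv1⟩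
  · -- `ℓ K → μ`
    have hek : ∀ k, e k = 32 / 125 / c * (1 / 5 : ℝ) ^ k := by
      intro k
      rw [he, one_div_pow]
      push_cast
      field_simp
      ring
    have h := (tendsto_partial_sums_not_mult_five (32 / 125 / c)).comp (tendsto_add_atTop_nat 1)
    have hμ : 32 / 125 / c * (1 / 4 - 1 / (5 ^ 5 - 1)) = 8 / 125 * (1 - 4 / (5 ^ 5 - 1)) / c := by
      field_simp
      ring
    rw [← hμ]
    refine h.congr fun K ↦ ?_
    simp only [Function.comp_apply, hℓ, hek, hS]
  · -- `ℓ K + f K → μ`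
    have hek : ∀ k, e k = 32 / 125 / c * (1 / 5 : ℝ) ^ k := by
      intro k
      rw [he, one_div_pow]
      push_cast
      field_simp
      ring
    have h := (tendsto_partial_sums_not_mult_five (32 / 125 / c)).comp (tendsto_add_atTop_nat 1)
    have hμ : 32 / 125 / c * (1 / 4 - 1 / (5 ^ 5 - 1)) = 8 / 125 * (1 - 4 / (5 ^ 5 - 1)) / c := by
      field_simp
      ring
    have hℓ' : Tendsto ℓ atTop (𝓝 (8 / 125 * (1 - 4 / (5 ^ 5 - 1)) / c)) := by
      rw [← hμ]
      refine h.congr fun K ↦ ?_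
      simp only [Function.comp_apply, hℓ, hek, hS]
    have hfK : ∀ K, f K = 2 / 125 / c * (1 / 5 : ℝ) ^ K := by
      intro K
      rw [hf, one_div_pow]
      push_cast
      field_simp
      ring
    have hf0 : Tendsto f atTop (𝓝 0) := by
      rw [show f = fun K ↦ 2 / 125 / c * (1 / 5 : ℝ) ^ K from funext hfK]
      rw [show (0 : ℝ) = 2 / 125 / c * 0 by ring]
      exact (tendsto_pow_atTop_nhds_zero_of_lt_one (by norm_num) (by norm_num)).const_mul _
    have := hℓ'.add hf0
    rwa [add_zero] at this

/-! ### The Tate-fifth-power residue set: `μ = 8/125 · 1/(5⁵ - 1) · (1 - 5⁻¹⁰)⁻¹ = 78125/3813476172` -/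

/-- Partial sums of `Σ_{k ≥ 1, 5 ∣ k} c·5^{-k}` over `k ≤ K` converge to `c/(5⁵-1)` (companion of
`tendsto_partial_sums_not_mult_five`: the complement `Σ_{k ≥ 1, 5 ∣ k} 5^{-k} = 1/(5⁵-1)` of the source's
`Σ_{k ≥ 1, 5 ∤ k} 5^{-k} = ¼(1 - 4/(5⁵-1))`). [cite: BhargavaSkinnerZhang2014, Lemma 18 (proof, p. 9: the sum over 5 ∤ k in μ₅(Σ₅^ns), μ₅(Σ₅^spl))] -/
theorem tendsto_partial_sums_mult_five (c : ℝ) :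
    Tendsto (fun K : ℕ ↦ ∑ k ∈ (Finset.range (K + 1)).filter (fun k ↦ 1 ≤ k ∧ 5 ∣ k),
      c * (1 / 5 : ℝ) ^ k) atTop (𝓝 (c * (1 / (5 ^ 5 - 1)))) := by
  have h := (hasSum_fifth_powers_mult_five.mul_left c).tendsto_sum_nat
  have h' := h.comp (tendsto_add_atTop_nat 1)
  refine h'.congr fun K ↦ ?_
  simp only [Function.comp_apply]
  rw [Finset.sum_filter]
  refine Finset.sum_congr rfl fun k _ ↦ ?_
  split_ifs <;> simp

open BSZSigmaNs BSZSigmaSpl in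
/-- **The Tate-fifth-power residue set has height density `78125/3813476172`** (inside the
source's `S₀(5) ∖ S₁'(5)` of Cor. 26's proof; the tree's piece `R = T₅`, the bundle `pub-bsdpct`'s `μ(T₅)`): the pairs with `A ≡ 3`, `B ≡ ±1 (mod 5)`, `5 ∣ k := ord₅(4A³+27B²)`
and `tateUnitResidue(5^k, A, (4A³+27B²)/5^k)⁴ ≡ 1 (mod 25)` — once read on the Tate parameter
(`PiecesFiveAdicCriteriaProofs.T₅_iff`, `TateJSecondOrderProofs` Part 2), the split curves with
`q_E ∈ (ℚ₅ˣ)⁵`, i.e. `E(ℚ₅)[5] ≠ 0` — have density `Σ_{k ≥ 1, 5 ∣ k} 8/5^{k+3}·(1-5⁻¹⁰)⁻¹ =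
8/125 · 1/(5⁵-1) · (1-5⁻¹⁰)⁻¹ = 78125/3813476172` (the constant of the binder `hR` of
`bsz_rankLeOne_cRank_of_pieces`; `BSZSigmaSpl.hasHeightDensity_ord_eq_pow_four_eq_one` summed and
squeezed as `hasHeightDensity_sigma_ns_five`). The source's Cor. 26 treats `S₀(5) ∖ S₁'(5)` as one set
(p. 12); its split by `E(ℚ₅)[5]` (Rem. 11: `5 ∣ k`; Tate: `q ∈ (ℚ₅ˣ)⁵`) is the tree's piece `R = T₅`.
[cite: BhargavaSkinnerZhang2014, Lemma 18 (proof, pp. 8–9) and Rem. 11 (p. 5) and Cor. 26 (proof, p. 12: S₀(5) ∖ S₁'(5))]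
[cite: SilvermanATAEC1994, Thm. V.5.3] [cite: BhargavaSkinner2014, proof of Lemma 16] -/
theorem hasHeightDensity_tateFifthPower_residues_five :
    HasHeightDensity (fun AB : ℤ × ℤ ↦ (AB.1 : ZMod 5) = 3 ∧ ((AB.2 : ZMod 5) = 1 ∨ (AB.2 : ZMod 5) = 4) ∧
        5 ∣ padicValInt 5 (4 * AB.1 ^ 3 + 27 * AB.2 ^ 2) ∧
        tateUnitResidue ((5 : ZMod (5 ^ 2)) ^ padicValInt 5 (4 * AB.1 ^ 3 + 27 * AB.2 ^ 2))
            (AB.1 : ZMod (5 ^ 2))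
            (((4 * AB.1 ^ 3 + 27 * AB.2 ^ 2) / 5 ^ padicValInt 5 (4 * AB.1 ^ 3 + 27 * AB.2 ^ 2) : ℤ) :
              ZMod (5 ^ 2)) ^ 4 = 1)
      (78125 / 3813476172) := by
  -- the pieces
  set D : ℤ × ℤ → ℤ := fun AB ↦ 4 * AB.1 ^ 3 + 27 * AB.2 ^ 2 with hD
  set C : ℕ → ℤ × ℤ → Prop := fun k AB ↦
    tateUnitResidue ((5 : ZMod (5 ^ 2)) ^ k) (AB.1 : ZMod (5 ^ 2)) ((D AB / 5 ^ k : ℤ) : ZMod (5 ^ 2))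
      ^ 4 = 1 with hC
  set E : ℕ → ℤ × ℤ → Prop := fun k AB ↦ (AB.1 : ZMod 5) = 3 ∧ ((5 : ℤ) ^ k ∣ D AB ∧
      ¬ (5 : ℤ) ^ (k + 1) ∣ D AB) ∧ C k AB with hE
  set S : ℕ → Finset ℕ := fun K ↦ (Finset.range (K + 1 + 1)).filter (fun k ↦ 1 ≤ k ∧ 5 ∣ k)
    with hS
  set L : ℕ → ℤ × ℤ → Prop := fun K AB ↦ ∃ k ∈ S K, E k AB with hL
  set F : ℕ → ℤ × ℤ → Prop := fun K AB ↦ (AB.1 : ZMod 5) = 3 ∧ (5 : ℤ) ^ (K + 1 + 1) ∣ D AB with hF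
  set U : ℕ → ℤ × ℤ → Prop := fun K AB ↦ L K AB ∨ F K AB with hU
  set c : ℝ := 1 - 1 / (5 : ℝ) ^ 10 with hc
  set e : ℕ → ℝ := fun k ↦ ((5 ^ (k + 1) * (2 * 4) : ℕ) : ℝ) / ((5 : ℝ) ^ (k + 2)) ^ 2 / c with he
  set f : ℕ → ℝ := fun K ↦ ((5 ^ (K + 1 + 1) * (2 * 5) : ℕ) : ℝ) / ((5 : ℝ) ^ (K + 1 + 2)) ^ 2 / c
    with hf
  set ℓ : ℕ → ℝ := fun K ↦ ∑ k ∈ S K, e k with hℓ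
  have hc0 : c ≠ 0 := by rw [hc]; norm_num
  have hμval : (78125 / 3813476172 : ℝ) = 8 / 125 * (1 / (5 ^ 5 - 1)) / c := by
    rw [hc]; norm_num
  rw [hμval]
  -- disjointness of the `E k`
  have hEdisj : ∀ i j : ℕ, i ≠ j → ∀ AB : ℤ × ℤ, E i AB → ¬ E j AB := by
    intro i j hij AB ⟨_, ⟨hi1, hi2⟩, _⟩ ⟨_, ⟨hj1, hj2⟩, _⟩
    rcases Nat.lt_or_gt_of_ne hij with h | h
    · exact hi2 ((pow_dvd_pow (5 : ℤ) (Nat.succ_le_of_lt h)).trans hj1)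
    · exact hj2 ((pow_dvd_pow (5 : ℤ) (Nat.succ_le_of_lt h)).trans hi1)
  -- densities of `L K` and `U K`
  have hLd : ∀ K, HasHeightDensity (L K) (ℓ K) := fun K ↦
    HasHeightDensity.finset_biSup (S K) E e
      (fun k hk ↦ by
        have hk1 : 1 ≤ k := ((Finset.mem_filter.mp hk).2).1
        exact hasHeightDensity_ord_eq_pow_four_eq_one hk1)
      (fun i _ j _ hij AB _ ↦ hEdisj i j hij AB)
  have hUd : ∀ K, HasHeightDensity (U K) (ℓ K + f K) := fun K ↦
    (hLd K).or_of_disjoint (BSZSigmaSpl.hasHeightDensity_ord_ge (K := K + 1) (by omega)) (by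
      rintro AB - ⟨k, hk, -, ⟨-, hk2⟩, -⟩ ⟨-, hF2⟩
      have hkK : k + 1 ≤ K + 1 + 1 := by
        have := Finset.mem_range.mp (Finset.mem_filter.mp hk).1
        omega
      exact hk2 ((pow_dvd_pow (5 : ℤ) hkK).trans hF2))
  -- residues: `A ≡ 3`, then `5 ∣ D ↔ B ≡ ±1`
  have hres : ∀ AB : ℤ × ℤ, (AB.1 : ZMod 5) = 3 →
      ((5 : ℤ) ∣ D AB ↔ ((AB.2 : ZMod 5) = 1 ∨ (AB.2 : ZMod 5) = 4)) := by
    intro AB hA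
    rw [← zmod5_disc_three, ← hA]
    have : (4 * (AB.1 : ZMod 5) ^ 3 + 27 * (AB.2 : ZMod 5) ^ 2) = ((D AB : ℤ) : ZMod 5) := by
      rw [hD]; push_cast; ring
    rw [this, ZMod.intCast_zmod_eq_zero_iff_dvd]
    push_cast
    rfl
  refine hasHeightDensity_of_squeeze L U ℓ (fun K ↦ ℓ K + f K) hLd hUd ?_ ?_ ?_ ?_
  · -- `L K ⊆` the set
    rintro K AB - ⟨k, hk, hA, ⟨hk1, hk2⟩, hCk⟩
    have hk' := (Finset.mem_filter.mp hk).2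
    refine ⟨hA, (hres AB hA).mp ((dvd_pow_self (5 : ℤ) (by omega)).trans hk1), ?_, ?_⟩
    · rw [show (4 * AB.1 ^ 3 + 27 * AB.2 ^ 2 : ℤ) = D AB from rfl,
        padicValInt_eq_of_dvd_of_not_dvd hk1 hk2]
      exact hk'.2
    · rw [show (4 * AB.1 ^ 3 + 27 * AB.2 ^ 2 : ℤ) = D AB from rfl,
        padicValInt_eq_of_dvd_of_not_dvd hk1 hk2]
      exact hCk
  · -- the set `⊆ U K`
    rintro K AB hfam ⟨hA, hB, hv, hCv⟩
    have hD0 : D AB ≠ 0 := hfam.1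
    rw [show (4 * AB.1 ^ 3 + 27 * AB.2 ^ 2 : ℤ) = D AB from rfl] at hv hCv
    have h5D : (5 : ℤ) ∣ D AB := (hres AB hA).mpr hB
    obtain ⟨hv1, hv2⟩ := dvd_and_not_dvd_padicValInt hD0
    have hv0 : 1 ≤ padicValInt 5 (D AB) := by
      by_contra h
      have h0 : padicValInt 5 (D AB) = 0 := by omega
      rw [h0, zero_add, pow_one] at hv2
      exact hv2 h5D
    by_cases hvK : padicValInt 5 (D AB) ≤ K + 1
    · left
      exact ⟨padicValInt 5 (D AB),
        Finset.mem_filter.mpr ⟨Finset.mem_range.mpr (by omega), hv0, hv⟩, hA, ⟨hv1, hv2⟩, hCv⟩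
    · right
      exact ⟨hA, (pow_dvd_pow (5 : ℤ) (by omega)).trans hv1⟩
  · -- `ℓ K → μ`
    have hek : ∀ k, e k = 8 / 125 / c * (1 / 5 : ℝ) ^ k := by
      intro k
      rw [he, one_div_pow]
      push_cast
      field_simp
      ring
    have h := (tendsto_partial_sums_mult_five (8 / 125 / c)).comp (tendsto_add_atTop_nat 1)
    have hμ : 8 / 125 / c * (1 / (5 ^ 5 - 1)) = 8 / 125 * (1 / (5 ^ 5 - 1)) / c := by
      field_simp
    rw [← hμ]
    refine h.congr fun K ↦ ?_
    simp only [Function.comp_apply, hℓ, hek, hS]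
  · -- `ℓ K + f K → μ`
    have hek : ∀ k, e k = 8 / 125 / c * (1 / 5 : ℝ) ^ k := by
      intro k
      rw [he, one_div_pow]
      push_cast
      field_simp
      ring
    have h := (tendsto_partial_sums_mult_five (8 / 125 / c)).comp (tendsto_add_atTop_nat 1)
    have hμ : 8 / 125 / c * (1 / (5 ^ 5 - 1)) = 8 / 125 * (1 / (5 ^ 5 - 1)) / c := by
      field_simp
    have hℓ' : Tendsto ℓ atTop (𝓝 (8 / 125 * (1 / (5 ^ 5 - 1)) / c)) := by
      rw [← hμ]
      refine h.congr fun K ↦ ?_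
      simp only [Function.comp_apply, hℓ, hek, hS]
    have hfK : ∀ K, f K = 2 / 125 / c * (1 / 5 : ℝ) ^ K := by
      intro K
      rw [hf, one_div_pow]
      push_cast
      field_simp
      ring
    have hf0 : Tendsto f atTop (𝓝 0) := by
      rw [show f = fun K ↦ 2 / 125 / c * (1 / 5 : ℝ) ^ K from funext hfK]
      rw [show (0 : ℝ) = 2 / 125 / c * 0 by ring]
      exact (tendsto_pow_atTop_nhds_zero_of_lt_one (by norm_num) (by norm_num)).const_mul _
    have := hℓ'.add hf0
    rwa [add_zero] at this

/-! ### The residue set of the slice `P = SP'`: `μ = 20546875/1271158724`, and the tails -/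

section SPprime

open BSZSigmaNs BSZSigmaSpl

/-- Predicates agreeing on the height family have the same height density. [folklore] -/
private theorem hasHeightDensity_congr' {P Q : ℤ × ℤ → Prop} {μ : ℝ}
    (h : ∀ AB, IsInHeightFamily AB → (P AB ↔ Q AB)) (hP : HasHeightDensity P μ) :
    HasHeightDensity Q μ :=
  hasHeightDensity_of_squeeze (fun _ ↦ P) (fun _ ↦ P) (fun _ ↦ μ) (fun _ ↦ μ) (fun _ ↦ hP)
    (fun _ ↦ hP) (fun _ AB hAB hPAB ↦ (h AB hAB).mp hPAB) (fun _ AB hAB hQAB ↦ (h AB hAB).mpr hQAB)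
    tendsto_const_nhds tendsto_const_nhds

/-- **The sum over `k` with a level condition `Q k` and a level-`k` residue condition `C k`** — the
common shape of the proofs of `hasHeightDensity_sigma_ns_five`, `hasHeightDensity_sigma_spl_five`,
`hasHeightDensity_tateFifthPower_residues_five`: if the level-`k` sets `{A ≡ a, ord₅(4A³+27B²) = k, C k}`
have densities `κ·5^{-k}` (`k ≥ 1`), the tails `{A ≡ a, 5^{K+1} ∣ 4A³+27B²}` have densities `f K → 0`,
and `Σ_{1 ≤ k ≤ K, Q k} κ·5^{-k} → κσ`, then `{A ≡ a, B-residues, Q(ord₅), C(ord₅)}` has density `κσ`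
(squeeze, `hasHeightDensity_of_squeeze`). [cite: BhargavaSkinnerZhang2014, Lemma 18 (proof: the sums over k)] -/
private theorem hasHeightDensity_ord_sum (a : ZMod 5) (Bres : ℤ × ℤ → Prop)
    (hres : ∀ AB : ℤ × ℤ, (AB.1 : ZMod 5) = a →
      ((5 : ℤ) ∣ 4 * AB.1 ^ 3 + 27 * AB.2 ^ 2 ↔ Bres AB))
    (C : ℕ → ℤ × ℤ → Prop) (Q : ℕ → Prop) [DecidablePred Q] (e : ℕ → ℝ) (κ : ℝ)
    (he : ∀ k, e k = κ * (1 / 5 : ℝ) ^ k)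
    (hE : ∀ k, 1 ≤ k → HasHeightDensity (fun AB : ℤ × ℤ ↦ (AB.1 : ZMod 5) = a ∧
      ((5 : ℤ) ^ k ∣ 4 * AB.1 ^ 3 + 27 * AB.2 ^ 2 ∧ ¬ (5 : ℤ) ^ (k + 1) ∣ 4 * AB.1 ^ 3 + 27 * AB.2 ^ 2) ∧
      C k AB) (e k))
    (f : ℕ → ℝ) (hF : ∀ K, 1 ≤ K → HasHeightDensity (fun AB : ℤ × ℤ ↦ (AB.1 : ZMod 5) = a ∧
      (5 : ℤ) ^ (K + 1) ∣ 4 * AB.1 ^ 3 + 27 * AB.2 ^ 2) (f K))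
    (hf0 : Tendsto f atTop (𝓝 0)) (σ : ℝ)
    (hσ : Tendsto (fun K : ℕ ↦ ∑ k ∈ (Finset.range (K + 1)).filter (fun k ↦ 1 ≤ k ∧ Q k),
      κ * (1 / 5 : ℝ) ^ k) atTop (𝓝 (κ * σ))) :
    HasHeightDensity (fun AB : ℤ × ℤ ↦ (AB.1 : ZMod 5) = a ∧ Bres AB ∧
        Q (padicValInt 5 (4 * AB.1 ^ 3 + 27 * AB.2 ^ 2)) ∧
        C (padicValInt 5 (4 * AB.1 ^ 3 + 27 * AB.2 ^ 2)) AB) (κ * σ) := by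
  set D : ℤ × ℤ → ℤ := fun AB ↦ 4 * AB.1 ^ 3 + 27 * AB.2 ^ 2 with hD
  set E : ℕ → ℤ × ℤ → Prop := fun k AB ↦ (AB.1 : ZMod 5) = a ∧ ((5 : ℤ) ^ k ∣ D AB ∧
      ¬ (5 : ℤ) ^ (k + 1) ∣ D AB) ∧ C k AB with hEdef
  set S : ℕ → Finset ℕ := fun K ↦ (Finset.range (K + 1 + 1)).filter (fun k ↦ 1 ≤ k ∧ Q k)
    with hS
  set L : ℕ → ℤ × ℤ → Prop := fun K AB ↦ ∃ k ∈ S K, E k AB with hL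
  set F : ℕ → ℤ × ℤ → Prop := fun K AB ↦ (AB.1 : ZMod 5) = a ∧ (5 : ℤ) ^ (K + 1 + 1) ∣ D AB with hFdef
  set U : ℕ → ℤ × ℤ → Prop := fun K AB ↦ L K AB ∨ F K AB with hU
  set ℓ : ℕ → ℝ := fun K ↦ ∑ k ∈ S K, e k with hℓ
  -- disjointness of the `E k`
  have hEdisj : ∀ i j : ℕ, i ≠ j → ∀ AB : ℤ × ℤ, E i AB → ¬ E j AB := by
    intro i j hij AB ⟨_, ⟨hi1, hi2⟩, _⟩ ⟨_, ⟨hj1, hj2⟩, _⟩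
    rcases Nat.lt_or_gt_of_ne hij with h | h
    · exact hi2 ((pow_dvd_pow (5 : ℤ) (Nat.succ_le_of_lt h)).trans hj1)
    · exact hj2 ((pow_dvd_pow (5 : ℤ) (Nat.succ_le_of_lt h)).trans hi1)
  have hLd : ∀ K, HasHeightDensity (L K) (ℓ K) := fun K ↦
    HasHeightDensity.finset_biSup (S K) E e
      (fun k hk ↦ hE k ((Finset.mem_filter.mp hk).2).1)
      (fun i _ j _ hij AB _ ↦ hEdisj i j hij AB)
  have hUd : ∀ K, HasHeightDensity (U K) (ℓ K + f (K + 1)) := fun K ↦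
    (hLd K).or_of_disjoint (hF (K + 1) (by omega)) (by
      rintro AB - ⟨k, hk, -, ⟨-, hk2⟩, -⟩ ⟨-, hF2⟩
      have hkK : k + 1 ≤ K + 1 + 1 := by
        have := Finset.mem_range.mp (Finset.mem_filter.mp hk).1
        omega
      exact hk2 ((pow_dvd_pow (5 : ℤ) hkK).trans hF2))
  refine hasHeightDensity_of_squeeze L U ℓ (fun K ↦ ℓ K + f (K + 1)) hLd hUd ?_ ?_ ?_ ?_
  · -- `L K ⊆` the set
    rintro K AB - ⟨k, hk, hA, ⟨hk1, hk2⟩, hCk⟩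
    have hk' := (Finset.mem_filter.mp hk).2
    have hv : padicValInt 5 (4 * AB.1 ^ 3 + 27 * AB.2 ^ 2) = k := padicValInt_eq_of_dvd_of_not_dvd hk1 hk2
    refine ⟨hA, (hres AB hA).mp ((dvd_pow_self (5 : ℤ) (by omega)).trans hk1), ?_, ?_⟩
    · rw [hv]; exact hk'.2
    · rw [hv]; exact hCk
  · -- the set `⊆ U K`
    rintro K AB hfam ⟨hA, hB, hQ, hCv⟩
    have hD0 : D AB ≠ 0 := hfam.1
    have h5D : (5 : ℤ) ∣ D AB := (hres AB hA).mpr hB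
    obtain ⟨hv1, hv2⟩ := dvd_and_not_dvd_padicValInt hD0
    have hv0 : 1 ≤ padicValInt 5 (D AB) := by
      by_contra h
      have h0 : padicValInt 5 (D AB) = 0 := by omega
      rw [h0, zero_add, pow_one] at hv2
      exact hv2 h5D
    by_cases hvK : padicValInt 5 (D AB) ≤ K + 1
    · left
      exact ⟨padicValInt 5 (D AB),
        Finset.mem_filter.mpr ⟨Finset.mem_range.mpr (by omega), hv0, hQ⟩, hA, ⟨hv1, hv2⟩, hCv⟩
    · right
      exact ⟨hA, (pow_dvd_pow (5 : ℤ) (by omega)).trans hv1⟩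
  · -- `ℓ K → κσ`
    have h := hσ.comp (tendsto_add_atTop_nat 1)
    refine h.congr fun K ↦ ?_
    simp only [Function.comp_apply, hℓ, he, hS]
  · -- `ℓ K + f (K+1) → κσ`
    have hℓ' : Tendsto ℓ atTop (𝓝 (κ * σ)) := by
      have h := hσ.comp (tendsto_add_atTop_nat 1)
      refine h.congr fun K ↦ ?_
      simp only [Function.comp_apply, hℓ, he, hS]
    have hf1 : Tendsto (fun K : ℕ ↦ f (K + 1)) atTop (𝓝 0) := hf0.comp (tendsto_add_atTop_nat 1)
    have := hℓ'.add hf1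
    rwa [add_zero] at this

/-- The tail densities `{A ≡ a, 5^{K+1} ∣ 4A³+27B²}` (`a = 2, 3`): `10·5^{K+1}/5^{2(K+2)}·(1-5⁻¹⁰)⁻¹ =
2/25·5^{-K}·(1-5⁻¹⁰)⁻¹ → 0`. [folklore] -/
private theorem tendsto_tail_density :
    Tendsto (fun K : ℕ ↦ ((5 ^ (K + 1) * (2 * 5) : ℕ) : ℝ) / ((5 : ℝ) ^ (K + 2)) ^ 2 /
      (1 - 1 / (5 : ℝ) ^ 10)) atTop (𝓝 0) := by
  have hc0 : (1 - 1 / (5 : ℝ) ^ 10) ≠ 0 := by norm_num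
  have hfK : ∀ K : ℕ, ((5 ^ (K + 1) * (2 * 5) : ℕ) : ℝ) / ((5 : ℝ) ^ (K + 2)) ^ 2 /
      (1 - 1 / (5 : ℝ) ^ 10) = 2 / 25 / (1 - 1 / (5 : ℝ) ^ 10) * (1 / 5 : ℝ) ^ K := by
    intro K
    rw [one_div_pow]
    push_cast
    field_simp
    ring
  rw [show (fun K : ℕ ↦ ((5 ^ (K + 1) * (2 * 5) : ℕ) : ℝ) / ((5 : ℝ) ^ (K + 2)) ^ 2 /
      (1 - 1 / (5 : ℝ) ^ 10)) = fun K ↦ 2 / 25 / (1 - 1 / (5 : ℝ) ^ 10) * (1 / 5 : ℝ) ^ K from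
    funext hfK]
  rw [show (0 : ℝ) = 2 / 25 / (1 - 1 / (5 : ℝ) ^ 10) * 0 by ring]
  exact (tendsto_pow_atTop_nhds_zero_of_lt_one (by norm_num) (by norm_num)).const_mul _

/-- **`{A ≡ 2, B ≡ ±2 (mod 5), 5 ∣ ord₅(4A³+27B²)}`** — the non-split multiplicative residue classes
with `5 ∣ k` (the non-split part of `S₀(5) ∖ S₁'(5)`, proof of Cor. 26) — has height density
`8/25·1/(5⁵-1)·(1-5⁻¹⁰)⁻¹` (`BSZSigmaNs.hasHeightDensity_ord_eq` summed over `5 ∣ k`).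
[cite: BhargavaSkinnerZhang2014, Cor. 26 (proof, p. 12: the set S₀(5) ∖ S₁'(5)) and Lemma 18 (proof, pp. 8–9) and Rem. 11 (p. 5)] -/
theorem hasHeightDensity_sigma_ns_mult_five :
    HasHeightDensity (fun AB : ℤ × ℤ ↦ (AB.1 : ZMod 5) = 2 ∧ ((AB.2 : ZMod 5) = 2 ∨ (AB.2 : ZMod 5) = 3) ∧
        5 ∣ padicValInt 5 (4 * AB.1 ^ 3 + 27 * AB.2 ^ 2))
      (8 / 25 / (1 - 1 / (5 : ℝ) ^ 10) * (1 / (5 ^ 5 - 1))) := by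
  have hc0 : (1 - 1 / (5 : ℝ) ^ 10) ≠ 0 := by norm_num
  have h := hasHeightDensity_ord_sum 2
    (fun AB ↦ (AB.2 : ZMod 5) = 2 ∨ (AB.2 : ZMod 5) = 3)
    (fun AB hA ↦ by
      rw [← zmod5_disc_two, ← hA]
      have : (4 * (AB.1 : ZMod 5) ^ 3 + 27 * (AB.2 : ZMod 5) ^ 2) =
          ((4 * AB.1 ^ 3 + 27 * AB.2 ^ 2 : ℤ) : ZMod 5) := by push_cast; ring
      rw [this, ZMod.intCast_zmod_eq_zero_iff_dvd]; push_cast; rfl)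
    (fun _ _ ↦ True) (fun k ↦ 5 ∣ k)
    (fun k ↦ ((5 ^ (k + 1) * (2 * 20) : ℕ) : ℝ) / ((5 : ℝ) ^ (k + 2)) ^ 2 / (1 - 1 / (5 : ℝ) ^ 10))
    (8 / 25 / (1 - 1 / (5 : ℝ) ^ 10))
    (fun k ↦ by rw [one_div_pow]; push_cast; field_simp; ring)
    (fun k hk ↦ hasHeightDensity_congr' (fun AB _ ↦ by simp only [and_true])
      (BSZSigmaNs.hasHeightDensity_ord_eq hk))
    _ (fun K hK ↦ BSZSigmaNs.hasHeightDensity_ord_ge hK) tendsto_tail_density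
    (1 / (5 ^ 5 - 1)) (tendsto_partial_sums_mult_five _)
  exact hasHeightDensity_congr' (fun AB _ ↦ by simp only [and_true]) h

/-- **`{A ≡ 3, B ≡ ±1 (mod 5), 5 ∣ k, tateUnitResidue(5^k, A, Δ'/5^k)⁴ ≢ 1}`** — split, `5 ∣ k`,
`q_E ∉ (ℚ₅ˣ)⁵` (the split part of the slice `SP'` with `5 ∣ k`) — has height density
`32/125·1/(5⁵-1)·(1-5⁻¹⁰)⁻¹`. [cite: BhargavaSkinnerZhang2014, Cor. 26 (proof, p. 12: S₀(5) ∖ S₁'(5)) and Lemma 18 (proof, pp. 8–9) and Rem. 11 (p. 5)]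
[cite: SilvermanATAEC1994, Thm. V.5.3] -/
theorem hasHeightDensity_split_mult_five_pow_four_ne_one :
    HasHeightDensity (fun AB : ℤ × ℤ ↦ (AB.1 : ZMod 5) = 3 ∧ ((AB.2 : ZMod 5) = 1 ∨ (AB.2 : ZMod 5) = 4) ∧
        5 ∣ padicValInt 5 (4 * AB.1 ^ 3 + 27 * AB.2 ^ 2) ∧
        tateUnitResidue ((5 : ZMod (5 ^ 2)) ^ padicValInt 5 (4 * AB.1 ^ 3 + 27 * AB.2 ^ 2))
            (AB.1 : ZMod (5 ^ 2))
            (((4 * AB.1 ^ 3 + 27 * AB.2 ^ 2) / 5 ^ padicValInt 5 (4 * AB.1 ^ 3 + 27 * AB.2 ^ 2) : ℤ) :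
              ZMod (5 ^ 2)) ^ 4 ≠ 1)
      (32 / 125 / (1 - 1 / (5 : ℝ) ^ 10) * (1 / (5 ^ 5 - 1))) := by
  have hc0 : (1 - 1 / (5 : ℝ) ^ 10) ≠ 0 := by norm_num
  exact hasHeightDensity_ord_sum 3
    (fun AB ↦ (AB.2 : ZMod 5) = 1 ∨ (AB.2 : ZMod 5) = 4)
    (fun AB hA ↦ by
      rw [← zmod5_disc_three, ← hA]
      have : (4 * (AB.1 : ZMod 5) ^ 3 + 27 * (AB.2 : ZMod 5) ^ 2) =
          ((4 * AB.1 ^ 3 + 27 * AB.2 ^ 2 : ℤ) : ZMod 5) := by push_cast; ring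
      rw [this, ZMod.intCast_zmod_eq_zero_iff_dvd]; push_cast; rfl)
    (fun k AB ↦ tateUnitResidue ((5 : ZMod (5 ^ 2)) ^ k) (AB.1 : ZMod (5 ^ 2))
      (((4 * AB.1 ^ 3 + 27 * AB.2 ^ 2) / 5 ^ k : ℤ) : ZMod (5 ^ 2)) ^ 4 ≠ 1)
    (fun k ↦ 5 ∣ k)
    (fun k ↦ ((5 ^ (k + 1) * (2 * 16) : ℕ) : ℝ) / ((5 : ℝ) ^ (k + 2)) ^ 2 / (1 - 1 / (5 : ℝ) ^ 10))
    (32 / 125 / (1 - 1 / (5 : ℝ) ^ 10))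
    (fun k ↦ by rw [one_div_pow]; push_cast; field_simp; ring)
    (fun k hk ↦ hasHeightDensity_ord_eq_pow_four_ne_one hk)
    _ (fun K hK ↦ BSZSigmaSpl.hasHeightDensity_ord_ge hK) tendsto_tail_density
    (1 / (5 ^ 5 - 1)) (tendsto_partial_sums_mult_five _)

/-- **`{A ≡ 3, B ≡ ±1 (mod 5), 5 ∤ k, tateUnitResidue(5^k, A, Δ'/5^k)⁴ ≡ 1}`** — split, `5 ∤ k`,
`ord₅ 𝓛 ≠ 1` (the split part of the slice `SP'` with `5 ∤ k`) — has height density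
`8/125·(1/4 - 1/(5⁵-1))·(1-5⁻¹⁰)⁻¹`. [cite: BhargavaSkinnerZhang2014, Cor. 26 (proof, p. 12: S₀(5) ∖ S₁'(5)) and Lemma 18 (proof, pp. 8–9)]
[cite: SilvermanATAEC1994, Thm. V.5.3] -/
theorem hasHeightDensity_split_not_mult_five_pow_four_eq_one :
    HasHeightDensity (fun AB : ℤ × ℤ ↦ (AB.1 : ZMod 5) = 3 ∧ ((AB.2 : ZMod 5) = 1 ∨ (AB.2 : ZMod 5) = 4) ∧
        ¬ 5 ∣ padicValInt 5 (4 * AB.1 ^ 3 + 27 * AB.2 ^ 2) ∧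
        tateUnitResidue ((5 : ZMod (5 ^ 2)) ^ padicValInt 5 (4 * AB.1 ^ 3 + 27 * AB.2 ^ 2))
            (AB.1 : ZMod (5 ^ 2))
            (((4 * AB.1 ^ 3 + 27 * AB.2 ^ 2) / 5 ^ padicValInt 5 (4 * AB.1 ^ 3 + 27 * AB.2 ^ 2) : ℤ) :
              ZMod (5 ^ 2)) ^ 4 = 1)
      (8 / 125 / (1 - 1 / (5 : ℝ) ^ 10) * (1 / 4 - 1 / (5 ^ 5 - 1))) := by
  have hc0 : (1 - 1 / (5 : ℝ) ^ 10) ≠ 0 := by norm_num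
  exact hasHeightDensity_ord_sum 3
    (fun AB ↦ (AB.2 : ZMod 5) = 1 ∨ (AB.2 : ZMod 5) = 4)
    (fun AB hA ↦ by
      rw [← zmod5_disc_three, ← hA]
      have : (4 * (AB.1 : ZMod 5) ^ 3 + 27 * (AB.2 : ZMod 5) ^ 2) =
          ((4 * AB.1 ^ 3 + 27 * AB.2 ^ 2 : ℤ) : ZMod 5) := by push_cast; ring
      rw [this, ZMod.intCast_zmod_eq_zero_iff_dvd]; push_cast; rfl)
    (fun k AB ↦ tateUnitResidue ((5 : ZMod (5 ^ 2)) ^ k) (AB.1 : ZMod (5 ^ 2))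
      (((4 * AB.1 ^ 3 + 27 * AB.2 ^ 2) / 5 ^ k : ℤ) : ZMod (5 ^ 2)) ^ 4 = 1)
    (fun k ↦ ¬ 5 ∣ k)
    (fun k ↦ ((5 ^ (k + 1) * (2 * 4) : ℕ) : ℝ) / ((5 : ℝ) ^ (k + 2)) ^ 2 / (1 - 1 / (5 : ℝ) ^ 10))
    (8 / 125 / (1 - 1 / (5 : ℝ) ^ 10))
    (fun k ↦ by rw [one_div_pow]; push_cast; field_simp; ring)
    (fun k hk ↦ hasHeightDensity_ord_eq_pow_four_eq_one hk)
    _ (fun K hK ↦ BSZSigmaSpl.hasHeightDensity_ord_ge hK) tendsto_tail_density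
    (1 / 4 - 1 / (5 ^ 5 - 1)) (tendsto_partial_sums_not_mult_five _)

/-- **The residue set of the slice `SP'` (untruncated) has height density `20546875/1271158724`**
(inside the source's `S₀(5) ∖ S₁'(5)` of Cor. 26's proof; the tree's piece `P`, the bundle `pub-bsdpct`'s
`μ(SP')` before the `10⁻⁶` truncation allowance):
`(A, B)` with `5 ∤ A` multiplicative at `5`, OUTSIDE `S₁'(5)` and with `E(ℚ₅)[5] = 0` once read on the
Tate parameter — non-split with `5 ∣ k`, or split with exactly one of `5 ∣ k`,
`tateUnitResidue(5^k, A, Δ'/5^k)⁴ ≡ 1` (`PiecesFiveAdicCriteriaProofs.SP'_iff`, `TateJSecondOrderProofs`):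
`8/25/(5⁵-1) + 32/125/(5⁵-1) + 8/125·(1/4 - 1/(5⁵-1))`, all `×(1-5⁻¹⁰)⁻¹`, `= 20546875/1271158724`.
The source's Cor. 26 treats `S₀(5) ∖ S₁'(5)` as one set (p. 12, "density at least .8 - .79179");
its split into `T₅` and `SP'` by `E(ℚ₅)[5]` is the tree's (`Pieces.lean`).
[cite: BhargavaSkinnerZhang2014, Cor. 26 (proof, p. 12: S₀(5) ∖ S₁'(5)) and Lemma 18 (proof, pp. 8–9) and Rem. 11 (p. 5)]
[cite: SilvermanATAEC1994, Thm. V.5.3] [cite: BhargavaSkinner2014, proof of Lemma 16] -/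
theorem hasHeightDensity_SPprime_residues_five :
    HasHeightDensity (fun AB : ℤ × ℤ ↦
        ((AB.1 : ZMod 5) = 2 ∧ ((AB.2 : ZMod 5) = 2 ∨ (AB.2 : ZMod 5) = 3) ∧
          5 ∣ padicValInt 5 (4 * AB.1 ^ 3 + 27 * AB.2 ^ 2)) ∨
        ((AB.1 : ZMod 5) = 3 ∧ ((AB.2 : ZMod 5) = 1 ∨ (AB.2 : ZMod 5) = 4) ∧
          5 ∣ padicValInt 5 (4 * AB.1 ^ 3 + 27 * AB.2 ^ 2) ∧
          tateUnitResidue ((5 : ZMod (5 ^ 2)) ^ padicValInt 5 (4 * AB.1 ^ 3 + 27 * AB.2 ^ 2))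
              (AB.1 : ZMod (5 ^ 2))
              (((4 * AB.1 ^ 3 + 27 * AB.2 ^ 2) / 5 ^ padicValInt 5 (4 * AB.1 ^ 3 + 27 * AB.2 ^ 2) : ℤ) :
                ZMod (5 ^ 2)) ^ 4 ≠ 1) ∨
        ((AB.1 : ZMod 5) = 3 ∧ ((AB.2 : ZMod 5) = 1 ∨ (AB.2 : ZMod 5) = 4) ∧
          ¬ 5 ∣ padicValInt 5 (4 * AB.1 ^ 3 + 27 * AB.2 ^ 2) ∧
          tateUnitResidue ((5 : ZMod (5 ^ 2)) ^ padicValInt 5 (4 * AB.1 ^ 3 + 27 * AB.2 ^ 2))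
              (AB.1 : ZMod (5 ^ 2))
              (((4 * AB.1 ^ 3 + 27 * AB.2 ^ 2) / 5 ^ padicValInt 5 (4 * AB.1 ^ 3 + 27 * AB.2 ^ 2) : ℤ) :
                ZMod (5 ^ 2)) ^ 4 = 1))
      (20546875 / 1271158724) := by
  have h1 := hasHeightDensity_sigma_ns_mult_five
  have h2 := hasHeightDensity_split_mult_five_pow_four_ne_one
  have h3 := hasHeightDensity_split_not_mult_five_pow_four_eq_one
  have h23 := h2.or_of_disjoint h3 (by
    rintro AB - ⟨-, -, hv, -⟩ ⟨-, -, hv', -⟩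
    exact hv' hv)
  have h := h1.or_of_disjoint h23 (by
    rintro AB - ⟨h2A, -⟩ (⟨h3A, -⟩ | ⟨h3A, -⟩)
    · rw [h2A] at h3A; exact absurd h3A (by decide)
    · rw [h2A] at h3A; exact absurd h3A (by decide))
  have hμ : (8 / 25 / (1 - 1 / (5 : ℝ) ^ 10) * (1 / (5 ^ 5 - 1)) +
      (32 / 125 / (1 - 1 / (5 : ℝ) ^ 10) * (1 / (5 ^ 5 - 1)) +
        8 / 125 / (1 - 1 / (5 : ℝ) ^ 10) * (1 / 4 - 1 / (5 ^ 5 - 1))) : ℝ) =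
      20546875 / 1271158724 := by
    norm_num
  rw [← hμ]
  exact h

/-- **The truncation tails**: `{A ≡ 2 or 3 (mod 5), 5^{K+1} ∣ 4A³+27B²}` has height density
`2·10·5^{K+1}/5^{2(K+2)}·(1-5⁻¹⁰)⁻¹ = 4/5^{K+2}·(1-5⁻¹⁰)⁻¹` (`≤ 10⁻⁶` for `K ≥ 8`) — the set by which
`SP'` and its truncation `SP'_K = SP' ∩ {ord₅ ≤ K}` differ at most (`BSZSigmaNs.hasHeightDensity_ord_ge`,
`BSZSigmaSpl.hasHeightDensity_ord_ge`). [cite: BhargavaSkinnerZhang2014, Lemma 18 (proof, p. 9: the tail k > K) and Cor. 26 (proof, p. 12)] -/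
theorem hasHeightDensity_mult_tail_five {K : ℕ} (hK : 1 ≤ K) :
    HasHeightDensity (fun AB : ℤ × ℤ ↦ ((AB.1 : ZMod 5) = 2 ∨ (AB.1 : ZMod 5) = 3) ∧
        (5 : ℤ) ^ (K + 1) ∣ 4 * AB.1 ^ 3 + 27 * AB.2 ^ 2)
      (((5 ^ (K + 1) * (2 * 5) : ℕ) : ℝ) / ((5 : ℝ) ^ (K + 2)) ^ 2 / (1 - 1 / (5 : ℝ) ^ 10) +
        ((5 ^ (K + 1) * (2 * 5) : ℕ) : ℝ) / ((5 : ℝ) ^ (K + 2)) ^ 2 / (1 - 1 / (5 : ℝ) ^ 10)) := by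
  have h := (BSZSigmaNs.hasHeightDensity_ord_ge hK).or_of_disjoint
    (BSZSigmaSpl.hasHeightDensity_ord_ge hK) (by
      rintro AB - ⟨h2, -⟩ ⟨h3, -⟩
      rw [h2] at h3; exact absurd h3 (by decide))
  refine hasHeightDensity_congr' (fun AB _ ↦ ?_) h
  constructor
  · rintro (⟨h2, hd⟩ | ⟨h3, hd⟩)
    · exact ⟨Or.inl h2, hd⟩
    · exact ⟨Or.inr h3, hd⟩
  · rintro ⟨h2 | h3, hd⟩
    · exact Or.inl ⟨h2, hd⟩
    · exact Or.inr ⟨h3, hd⟩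

/-- The tail density is at most `10⁻⁶` for `K ≥ 8` (`4/5^{10}·(1-5⁻¹⁰)⁻¹ < 10⁻⁶`): the truncation
allowance `1/1000000` in the binder `hPd` of `bsz_rankLeOne_cRank_of_pieces` (the tree's; the source's
analogous allowance is the `.00001` of Cor. 26's proof). [cite: BhargavaSkinnerZhang2014, Cor. 26 (proof, pp. 11–12)] -/
theorem mult_tail_density_le {K : ℕ} (hK : 8 ≤ K) :
    ((5 ^ (K + 1) * (2 * 5) : ℕ) : ℝ) / ((5 : ℝ) ^ (K + 2)) ^ 2 / (1 - 1 / (5 : ℝ) ^ 10) +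
        ((5 ^ (K + 1) * (2 * 5) : ℕ) : ℝ) / ((5 : ℝ) ^ (K + 2)) ^ 2 / (1 - 1 / (5 : ℝ) ^ 10) ≤
      1 / 1000000 := by
  have hc0 : (0 : ℝ) < 1 - 1 / (5 : ℝ) ^ 10 := by norm_num
  have hfK : ((5 ^ (K + 1) * (2 * 5) : ℕ) : ℝ) / ((5 : ℝ) ^ (K + 2)) ^ 2 / (1 - 1 / (5 : ℝ) ^ 10) =
      2 / 25 / (1 - 1 / (5 : ℝ) ^ 10) * (1 / 5 : ℝ) ^ K := by
    rw [one_div_pow]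
    push_cast
    field_simp
    ring
  rw [hfK]
  have hpow : (1 / 5 : ℝ) ^ K ≤ (1 / 5 : ℝ) ^ 8 :=
    pow_le_pow_of_le_one (by norm_num) (by norm_num) hK
  have h8 : 2 / 25 / (1 - 1 / (5 : ℝ) ^ 10) * (1 / 5 : ℝ) ^ 8 +
      2 / 25 / (1 - 1 / (5 : ℝ) ^ 10) * (1 / 5 : ℝ) ^ 8 ≤ 1 / 1000000 := by norm_num
  have hpos : 0 ≤ 2 / 25 / (1 - 1 / (5 : ℝ) ^ 10) := by positivity
  nlinarith [mul_le_mul_of_nonneg_left hpow hpos]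

end SPprime

end Literature.NumberTheory.EllipticCurves

end
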